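import Literature.RingTheory.RegularLocalRing.AdicGeneration
import Mathlib.RingTheory.Noetherian.Basic
import Mathlib.LinearAlgebra.Isomorphisms
import Mathlib.RingTheory.Ideal.Quotient.Operations
import HarnessLib

/-!
# Adic towers of modules with a Noetherian obstruction module (Grothendieck's existence
argument for sections, SGA 2 IX–XI, made elementary)

Topic `Literature/RingTheory/RegularLocalRing`. Abstract form of the algebraisation of the
modules of sections `M_a = Γ(U, ℒ_a)` of a compatible system of invertible sheaves `ℒ_a` on the
punctured spectra of `S/t^a S`, `a ≥ 0`, as used for the complete case `hC` of
`Grothendieck1968_samuelConjecture_hypersurface` (SGA 2 XI 3.13 (ii) for hypersurfaces). The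
data: `S`-modules `M a` (`M 0 = 0`), reduction maps `red a b : M a → M b` (`b ≤ a`),
injective maps `tup a b : M b → M a` ("multiplication by `t^{a-b}`") with
`red ∘ tup = t^{a-b} = tup ∘ red`, `red_{a→b} ∘ tup_{(a-b)→a} = 0`,
`ker red_{a→b} = tup (M (a-b))`, and obstruction maps `δ a : M a → H` into a NOETHERIAN module
`H` killed by `𝔞^{K₀}`, with `ker δ_a = im red_{a+1→a}` and `δ_a ∘ tup_{b→a} = δ_b`.

Conclusions (`exists_limit_of_adicTower`): the images `E_a = im δ_a` increase and stabilise
(`H` Noetherian), whence the images `im (M_a → M_b)` are stationary for `a ≥ b + n₀`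
(uniform Mittag-Leffler, `range_red_eq_of_le`), consecutive stable images surject onto each
other, and the inverse limit `L` (compatible families) satisfies: `L → D := stable image in
M 1` is onto with kernel `t L`; `L` is `t`-torsion-free; `𝔞^{K₀ n₀} M 1 ⊆ D`; and, when `S`
is Noetherian and `𝔞`-adically complete with `t ∈ 𝔞 ⊆ rad S` and `M 1` finite, `L` is a
finite `S`-module (`AdicGeneration`). This replaces the finiteness theorem + EGA 0_III 13.7.7
of SGA 2 IX 1–2 in the special situation where the first cohomology of the special fibre is
Noetherian.

Everything is proved; no named facts, no new definitions (the limit is described by its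
membership condition).

## References

* [Grothendieck1968SGA2] A. Grothendieck, SGA 2, Exp. IX Thm. 1.1, Prop. 2.1, Thm. 2.2;
  Exp. XI Prop. 1.1, Thm. 3.13 (ii) (arXiv:math/0511279, pp. 55–58, 68, 72).
-/

noncomputable section

universe u

namespace Literature.RingTheory.RegularLocalRing

open Finset
open scoped Pointwise

section Tower

variable {S : Type u} [CommRing S] {t : S} {M : ℕ → Type u} [∀ a, AddCommGroup (M a)]
  [∀ a, Module S (M a)] (red : ∀ a b : ℕ, b ≤ a → (M a →ₗ[S] M b))
  (tup : ∀ a b : ℕ, b ≤ a → (M b →ₗ[S] M a))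
  {H : Type u} [AddCommGroup H] [Module S H] (δ : ∀ a : ℕ, M a →ₗ[S] H)

/-! ## Stabilisation of the obstruction images and uniform Mittag-Leffler -/

/-- The obstruction images `E_a = im δ_a` increase with the level (`δ_a ∘ tup = δ_b`).
[folklore] -/
theorem range_d_mono (hd_tup : ∀ (a b : ℕ) (h : b ≤ a) (y : M b), δ a (tup a b h y) = δ b y)
    {a b : ℕ} (h : b ≤ a) : LinearMap.range (δ b) ≤ LinearMap.range (δ a) := by
  rintro _ ⟨y, rfl⟩
  exact ⟨tup a b h y, hd_tup a b h y⟩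

/-- **The obstruction images stabilise** when `H` is Noetherian. [folklore] -/
theorem exists_range_d_eq [IsNoetherian S H]
    (hd_tup : ∀ (a b : ℕ) (h : b ≤ a) (y : M b), δ a (tup a b h y) = δ b y) :
    ∃ n₀ : ℕ, ∀ a : ℕ, n₀ ≤ a → LinearMap.range (δ a) = LinearMap.range (δ n₀) := by
  let f : ℕ →o Submodule S H :=
    ⟨fun a => LinearMap.range (δ a), fun a b h => range_d_mono tup δ hd_tup h⟩
  obtain ⟨n₀, hn₀⟩ := monotone_stabilizes_iff_noetherian.mpr inferInstance f
  exact ⟨n₀, fun a ha => (hn₀ a ha).symm⟩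

/-- **One Mittag-Leffler step** (SGA 2 XI 1.1 in module form): if the obstructions at level `a`
already occur at level `a - b`, then every element of `M b` that lifts to level `a` lifts to
level `a + 1`. [cite: Grothendieck1968SGA2, Exp. XI Prop. 1.1] -/
theorem range_red_le_range_red_succ
    (hrr : ∀ (a b c : ℕ) (hba : b ≤ a) (hcb : c ≤ b) (x : M a),
      red b c hcb (red a b hba x) = red a c (hcb.trans hba) x)
    (hrt0 : ∀ (a b : ℕ) (h : b ≤ a) (y : M (a - b)),
      red a b h (tup a (a - b) (Nat.sub_le a b) y) = 0)
    (hd_ker : ∀ (a : ℕ) (x : M a), δ a x = 0 → ∃ y : M (a + 1), red (a + 1) a (Nat.le_succ a) y = x)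
    (hd_tup : ∀ (a b : ℕ) (h : b ≤ a) (y : M b), δ a (tup a b h y) = δ b y)
    {a b : ℕ} (h : b ≤ a) (hE : LinearMap.range (δ a) ≤ LinearMap.range (δ (a - b))) :
    LinearMap.range (red a b h) ≤ LinearMap.range (red (a + 1) b (h.trans (Nat.le_succ a))) := by
  rintro _ ⟨x', rfl⟩
  obtain ⟨y, hy⟩ := hE ⟨x', rfl⟩
  -- `δ_a (x' - tup y) = 0`, so `x' - tup y` lifts
  have h0 : δ a (x' - tup a (a - b) (Nat.sub_le a b) y) = 0 := by
    rw [map_sub, hd_tup, hy, sub_self]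
  obtain ⟨x'', hx''⟩ := hd_ker a _ h0
  refine ⟨x'', ?_⟩
  rw [← hrr (a + 1) a b (Nat.le_succ a) h x'', hx'', map_sub, hrt0, sub_zero]

/-- **Uniform Mittag-Leffler**: with `n₀` as in `exists_range_d_eq`, the images
`im (M_a → M_b)` are stationary for `a ≥ b + n₀`.
[cite: Grothendieck1968SGA2, Exp. IX Thm. 1.1 (iv)] -/
theorem range_red_eq_of_le
    (hrr : ∀ (a b c : ℕ) (hba : b ≤ a) (hcb : c ≤ b) (x : M a),
      red b c hcb (red a b hba x) = red a c (hcb.trans hba) x)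
    (hrt0 : ∀ (a b : ℕ) (h : b ≤ a) (y : M (a - b)),
      red a b h (tup a (a - b) (Nat.sub_le a b) y) = 0)
    (hd_ker : ∀ (a : ℕ) (x : M a), δ a x = 0 → ∃ y : M (a + 1), red (a + 1) a (Nat.le_succ a) y = x)
    (hd_tup : ∀ (a b : ℕ) (h : b ≤ a) (y : M b), δ a (tup a b h y) = δ b y)
    {n₀ : ℕ} (hn₀ : ∀ a : ℕ, n₀ ≤ a → LinearMap.range (δ a) = LinearMap.range (δ n₀))
    (b k : ℕ) :
    LinearMap.range (red (n₀ + b + k) b (by omega)) = LinearMap.range (red (n₀ + b) b (by omega)) := by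
  induction k with
  | zero => rfl
  | succ k ih =>
    rw [← ih]
    apply le_antisymm
    · rintro _ ⟨x, rfl⟩
      exact ⟨red (n₀ + b + (k + 1)) (n₀ + b + k) (by omega) x, hrr _ _ _ _ _ x⟩
    · have hE : LinearMap.range (δ (n₀ + b + k)) ≤ LinearMap.range (δ (n₀ + b + k - b)) := by
        rw [hn₀ (n₀ + b + k) (by omega), hn₀ (n₀ + b + k - b) (by omega)]
      exact range_red_le_range_red_succ red tup δ hrr hrt0 hd_ker hd_tup (by omega) hE

/-- **Consecutive stable images surject onto each other.**
[cite: Grothendieck1968SGA2, Exp. IX Thm. 1.1] -/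
theorem exists_red_eq_of_mem_range
    (hrr : ∀ (a b c : ℕ) (hba : b ≤ a) (hcb : c ≤ b) (x : M a),
      red b c hcb (red a b hba x) = red a c (hcb.trans hba) x)
    (hrt0 : ∀ (a b : ℕ) (h : b ≤ a) (y : M (a - b)),
      red a b h (tup a (a - b) (Nat.sub_le a b) y) = 0)
    (hd_ker : ∀ (a : ℕ) (x : M a), δ a x = 0 → ∃ y : M (a + 1), red (a + 1) a (Nat.le_succ a) y = x)
    (hd_tup : ∀ (a b : ℕ) (h : b ≤ a) (y : M b), δ a (tup a b h y) = δ b y)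
    {n₀ : ℕ} (hn₀ : ∀ a : ℕ, n₀ ≤ a → LinearMap.range (δ a) = LinearMap.range (δ n₀))
    (b : ℕ) {x : M b} (hx : x ∈ LinearMap.range (red (n₀ + b) b (by omega))) :
    ∃ y : M (b + 1), y ∈ LinearMap.range (red (n₀ + (b + 1)) (b + 1) (by omega)) ∧
      red (b + 1) b (Nat.le_succ b) y = x := by
  have h1 : x ∈ LinearMap.range (red (n₀ + b + 1) b (by omega)) := by
    rw [range_red_eq_of_le red tup δ hrr hrt0 hd_ker hd_tup hn₀ b 1]; exact hx
  obtain ⟨x', rfl⟩ := h1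
  exact ⟨red (n₀ + b + 1) (b + 1) (by omega) x', ⟨x', rfl⟩, hrr _ _ _ _ _ x'⟩

/-! ## The inverse limit -/

/-- **Compatible lifts through the stable images**: every element of the stable image
`D = im (M_{1+n₀} → M_1)` is the level-`1` component of a compatible family.
[cite: Grothendieck1968SGA2, Exp. IX Thm. 1.1] -/
theorem exists_compatible_of_mem_range
    (hrid : ∀ (a : ℕ) (x : M a), red a a le_rfl x = x)
    (hrr : ∀ (a b c : ℕ) (hba : b ≤ a) (hcb : c ≤ b) (x : M a),
      red b c hcb (red a b hba x) = red a c (hcb.trans hba) x)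
    (hrt0 : ∀ (a b : ℕ) (h : b ≤ a) (y : M (a - b)),
      red a b h (tup a (a - b) (Nat.sub_le a b) y) = 0)
    (hd_ker : ∀ (a : ℕ) (x : M a), δ a x = 0 → ∃ y : M (a + 1), red (a + 1) a (Nat.le_succ a) y = x)
    (hd_tup : ∀ (a b : ℕ) (h : b ≤ a) (y : M b), δ a (tup a b h y) = δ b y)
    {n₀ : ℕ} (hn₀ : ∀ a : ℕ, n₀ ≤ a → LinearMap.range (δ a) = LinearMap.range (δ n₀))
    {x : M 1} (hx : x ∈ LinearMap.range (red (n₀ + 1) 1 (by omega))) :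
    ∃ z : ∀ a, M a, (∀ (a b : ℕ) (h : b ≤ a), red a b h (z a) = z b) ∧ z 1 = x := by
  -- the sequence of lifts, level `n + 1` at stage `n`
  let step : ∀ (n : ℕ) (y : {y : M (n + 1) // y ∈ LinearMap.range (red (n₀ + (n + 1)) (n + 1)
      (by omega))}), {y' : M (n + 1 + 1) // y' ∈ LinearMap.range (red (n₀ + (n + 1 + 1))
      (n + 1 + 1) (by omega))} := fun n y =>
    ⟨(exists_red_eq_of_mem_range red tup δ hrr hrt0 hd_ker hd_tup hn₀ (n + 1) y.2).choose,
      (exists_red_eq_of_mem_range red tup δ hrr hrt0 hd_ker hd_tup hn₀ (n + 1) y.2).choose_spec.1⟩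
  have step_spec : ∀ (n : ℕ) (y : {y : M (n + 1) // y ∈ LinearMap.range (red (n₀ + (n + 1))
      (n + 1) (by omega))}), red (n + 1 + 1) (n + 1) (Nat.le_succ _) (step n y).1 = y.1 :=
    fun n y =>
    (exists_red_eq_of_mem_range red tup δ hrr hrt0 hd_ker hd_tup hn₀ (n + 1) y.2).choose_spec.2
  let seq : ∀ n : ℕ, {y : M (n + 1) // y ∈ LinearMap.range (red (n₀ + (n + 1)) (n + 1)
      (by omega))} :=
    fun n => Nat.rec (motive := fun n => {y : M (n + 1) // y ∈ LinearMap.range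
      (red (n₀ + (n + 1)) (n + 1) (by omega))}) ⟨x, hx⟩ (fun n y => step n y) n
  have seq_zero : (seq 0).1 = x := rfl
  have seq_succ : ∀ n, seq (n + 1) = step n (seq n) := fun n => rfl
  let z : ∀ a, M a := fun a => match a with
    | 0 => red 1 0 (Nat.zero_le 1) x
    | (n + 1) => (seq n).1
  have hz0 : z 0 = red 1 0 (Nat.zero_le 1) x := rfl
  have hzs : ∀ n, z (n + 1) = (seq n).1 := fun n => rfl
  -- consecutive compatibility
  have hcons : ∀ n : ℕ, red (n + 1) n (Nat.le_succ n) (z (n + 1)) = z n := by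
    intro n
    cases n with
    | zero =>
      change red 1 0 _ (seq 0).1 = red 1 0 _ x
      rw [seq_zero]
    | succ n =>
      change red (n + 1 + 1) (n + 1) _ (seq (n + 1)).1 = (seq n).1
      rw [seq_succ, step_spec]
  -- compatibility along gaps
  have hgap : ∀ k b : ℕ, red (b + k) b (Nat.le_add_right b k) (z (b + k)) = z b := by
    intro k
    induction k with
    | zero => intro b; exact hrid b (z b)
    | succ k ih =>
      intro b
      rw [← hrr (b + (k + 1)) (b + k) b (by omega) (Nat.le_add_right b k), ← ih b]
      congr 1
      exact hcons (b + k)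
  refine ⟨z, fun a b h => ?_, rfl⟩
  obtain ⟨k, rfl⟩ := Nat.exists_eq_add_of_le h
  exact hgap k b

/-- **Finite colength of the stable image**: `𝔞^{K₀ n} M_1 ⊆ im (M_{n+1} → M_1)` when `𝔞^{K₀}`
kills the obstruction module. [cite: Grothendieck1968SGA2, Exp. XI Prop. 1.1] -/
theorem pow_smul_top_le_range_red (hrid : ∀ (a : ℕ) (x : M a), red a a le_rfl x = x)
    (hrr : ∀ (a b c : ℕ) (hba : b ≤ a) (hcb : c ≤ b) (x : M a),
      red b c hcb (red a b hba x) = red a c (hcb.trans hba) x)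
    (hd_ker : ∀ (a : ℕ) (x : M a), δ a x = 0 → ∃ y : M (a + 1), red (a + 1) a (Nat.le_succ a) y = x)
    (𝔞 : Ideal S) {K₀ : ℕ} (hH : ∀ r ∈ 𝔞 ^ K₀, ∀ h : H, r • h = 0) (n : ℕ) :
    𝔞 ^ (K₀ * n) • (⊤ : Submodule S (M 1)) ≤ LinearMap.range (red (n + 1) 1 (by omega)) := by
  induction n with
  | zero =>
    rintro x -
    exact ⟨x, hrid 1 x⟩
  | succ n ih =>
    rw [Nat.mul_succ, pow_add, mul_comm, Submodule.mul_smul]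
    refine (Submodule.smul_mono le_rfl ih).trans (Submodule.smul_le.mpr fun r hr y hy => ?_)
    obtain ⟨x', rfl⟩ := hy
    have h0 : δ (n + 1) (r • x') = 0 := by rw [map_smul, hH r hr]
    obtain ⟨x'', hx''⟩ := hd_ker (n + 1) _ h0
    refine ⟨x'', ?_⟩
    rw [← hrr (n + 1 + 1) (n + 1) 1 (Nat.le_succ _) (by omega) x'', hx'', map_smul]

/-! ## The limit: torsion, kernel and finiteness -/

/-- The level-`a` module is killed by `t^a` (`tup ∘ red = t^a` through `M 0 = 0`). [folklore] -/
theorem pow_smul_eq_zero_of_tower (hM0 : ∀ x : M 0, x = 0)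
    (htr : ∀ (a b : ℕ) (h : b ≤ a) (x : M a), tup a b h (red a b h x) = t ^ (a - b) • x)
    (a : ℕ) (x : M a) : t ^ a • x = 0 := by
  have h := htr a 0 (Nat.zero_le a) x
  rw [Nat.sub_zero] at h
  rw [← h, hM0 (red a 0 _ x), map_zero]

/-- Consecutive compatibility implies compatibility. [folklore] -/
theorem compatible_of_consecutive (hrid : ∀ (a : ℕ) (x : M a), red a a le_rfl x = x)
    (hrr : ∀ (a b c : ℕ) (hba : b ≤ a) (hcb : c ≤ b) (x : M a),
      red b c hcb (red a b hba x) = red a c (hcb.trans hba) x)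
    (z : ∀ a, M a) (hcons : ∀ n : ℕ, red (n + 1) n (Nat.le_succ n) (z (n + 1)) = z n)
    (a b : ℕ) (h : b ≤ a) : red a b h (z a) = z b := by
  have hgap : ∀ k b : ℕ, red (b + k) b (Nat.le_add_right b k) (z (b + k)) = z b := by
    intro k
    induction k with
    | zero => intro b; exact hrid b (z b)
    | succ k ih =>
      intro b
      rw [← hrr (b + (k + 1)) (b + k) b (by omega) (Nat.le_add_right b k), ← ih b]
      congr 1
      exact hcons (b + k)
  obtain ⟨k, rfl⟩ := Nat.exists_eq_add_of_le h
  exact hgap k b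

/-- **A compatible family killed by `t` is zero** (`tup` injective, `tup ∘ red = t`). [folklore] -/
theorem eq_zero_of_smul_eq_zero_of_compatible
    (htinj : ∀ (a b : ℕ) (h : b ≤ a), Function.Injective (tup a b h))
    (htr : ∀ (a b : ℕ) (h : b ≤ a) (x : M a), tup a b h (red a b h x) = t ^ (a - b) • x)
    (z : ∀ a, M a) (hz : ∀ (a b : ℕ) (h : b ≤ a), red a b h (z a) = z b)
    (ht : ∀ a, t • z a = 0) : z = 0 := by
  funext a
  apply htinj (a + 1) a (Nat.le_succ a)
  rw [Pi.zero_apply, map_zero, ← hz (a + 1) a (Nat.le_succ a), htr, Nat.add_sub_cancel_left,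
    pow_one, ht]

/-- **A compatible family vanishing at level `1` is `t` times a compatible family.**
[cite: Grothendieck1968SGA2, Exp. XI Prop. 1.1] -/
theorem exists_eq_smul_of_compatible_of_apply_one_eq_zero (hM0 : ∀ x : M 0, x = 0)
    (hrid : ∀ (a : ℕ) (x : M a), red a a le_rfl x = x)
    (hrr : ∀ (a b c : ℕ) (hba : b ≤ a) (hcb : c ≤ b) (x : M a),
      red b c hcb (red a b hba x) = red a c (hcb.trans hba) x)
    (htinj : ∀ (a b : ℕ) (h : b ≤ a), Function.Injective (tup a b h))
    (hrt : ∀ (a b : ℕ) (h : b ≤ a) (y : M b), red a b h (tup a b h y) = t ^ (a - b) • y)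
    (htr : ∀ (a b : ℕ) (h : b ≤ a) (x : M a), tup a b h (red a b h x) = t ^ (a - b) • x)
    (hker : ∀ (a b : ℕ) (h : b ≤ a) (x : M a), red a b h x = 0 →
      ∃ y : M (a - b), tup a (a - b) (Nat.sub_le a b) y = x)
    (x : ∀ a, M a) (hx : ∀ (a b : ℕ) (h : b ≤ a), red a b h (x a) = x b) (hx1 : x 1 = 0) :
    ∃ z : ∀ a, M a, (∀ (a b : ℕ) (h : b ≤ a), red a b h (z a) = z b) ∧ x = t • z := by
  -- `x (a+1) = tup (z a)`
  have hlift : ∀ a : ℕ, ∃ y : M a, tup (a + 1) a (Nat.le_succ a) y = x (a + 1) := by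
    intro a
    have h1 : red (a + 1) 1 (Nat.le_add_left 1 a) (x (a + 1)) = 0 := by rw [hx, hx1]
    obtain ⟨y, hy⟩ := hker (a + 1) 1 (Nat.le_add_left 1 a) (x (a + 1)) h1
    exact ⟨y, hy⟩
  choose z hz using hlift
  have hcons : ∀ n : ℕ, red (n + 1) n (Nat.le_succ n) (z (n + 1)) = z n := by
    intro n
    apply htinj (n + 1) n (Nat.le_succ n)
    rw [htr, Nat.add_sub_cancel_left, pow_one, hz n]
    -- `t • z (n+1) = red (tup (z (n+1))) = red (x (n+2)) = x (n+1)`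
    have h2 := congrArg (red (n + 1 + 1) (n + 1) (Nat.le_succ _)) (hz (n + 1))
    rw [hrt, Nat.add_sub_cancel_left, pow_one, hx] at h2
    exact h2
  refine ⟨z, compatible_of_consecutive red hrid hrr z hcons, funext fun a => ?_⟩
  cases a with
  | zero => rw [hM0 (x 0), hM0 ((t • z) 0)]
  | succ n =>
    rw [Pi.smul_apply, ← hz n, ← hcons n, htr, Nat.add_sub_cancel_left, pow_one]

/-- **The inverse limit of an adic tower with Noetherian obstruction module** (Grothendieck's
existence argument for sections, made elementary). See the module docstring for the data. Then
there are the submodule `L` of compatible families and the stable image `D ⊆ M 1` with: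
`𝔞^K M 1 ⊆ D`; `L → M 1` has image exactly `D` and kernel `t L`; `L` is `t`-torsion-free;
`L` is a finite `S`-module; `L / tL ≃ D`.
[cite: Grothendieck1968SGA2, Exp. IX Thm. 1.1, Thm. 2.2; Exp. XI Prop. 1.1] -/
theorem exists_limit_of_adicTower [IsNoetherianRing S] [IsNoetherian S H] [Module.Finite S (M 1)]
    (𝔞 : Ideal S) [IsAdicComplete 𝔞 S] (h𝔞 : 𝔞 ≤ Ideal.jacobson ⊥) (ht𝔞 : t ∈ 𝔞)
    (hM0 : ∀ x : M 0, x = 0)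
    (hrid : ∀ (a : ℕ) (x : M a), red a a le_rfl x = x)
    (hrr : ∀ (a b c : ℕ) (hba : b ≤ a) (hcb : c ≤ b) (x : M a),
      red b c hcb (red a b hba x) = red a c (hcb.trans hba) x)
    (htinj : ∀ (a b : ℕ) (h : b ≤ a), Function.Injective (tup a b h))
    (hrt : ∀ (a b : ℕ) (h : b ≤ a) (y : M b), red a b h (tup a b h y) = t ^ (a - b) • y)
    (htr : ∀ (a b : ℕ) (h : b ≤ a) (x : M a), tup a b h (red a b h x) = t ^ (a - b) • x)
    (hrt0 : ∀ (a b : ℕ) (h : b ≤ a) (y : M (a - b)),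
      red a b h (tup a (a - b) (Nat.sub_le a b) y) = 0)
    (hker : ∀ (a b : ℕ) (h : b ≤ a) (x : M a), red a b h x = 0 →
      ∃ y : M (a - b), tup a (a - b) (Nat.sub_le a b) y = x)
    (hd_ker : ∀ (a : ℕ) (x : M a), δ a x = 0 → ∃ y : M (a + 1), red (a + 1) a (Nat.le_succ a) y = x)
    (hd_tup : ∀ (a b : ℕ) (h : b ≤ a) (y : M b), δ a (tup a b h y) = δ b y)
    {K₀ : ℕ} (hH : ∀ r ∈ 𝔞 ^ K₀, ∀ h : H, r • h = 0) :
    ∃ (L : Submodule S (∀ a, M a)) (D : Submodule S (M 1)) (K : ℕ),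
      (∀ x : ∀ a, M a, x ∈ L ↔ ∀ (a b : ℕ) (h : b ≤ a), red a b h (x a) = x b) ∧
      𝔞 ^ K • (⊤ : Submodule S (M 1)) ≤ D ∧
      (∀ x ∈ L, x 1 ∈ D) ∧ (∀ d ∈ D, ∃ x ∈ L, x 1 = d) ∧
      (∀ x ∈ L, t • x = 0 → x = 0) ∧
      Module.Finite S L ∧
      Nonempty ((L ⧸ (t • ⊤ : Submodule S L)) ≃ₗ[S] D) := by
  classical
  -- the limit
  let L : Submodule S (∀ a, M a) :=
    { carrier := {x | ∀ (a b : ℕ) (h : b ≤ a), red a b h (x a) = x b}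
      add_mem' := fun {x x'} hx hx' a b h => by
        simp only [Pi.add_apply, map_add, hx a b h, hx' a b h]
      zero_mem' := fun a b h => by simp
      smul_mem' := fun c x hx a b h => by
        simp only [Pi.smul_apply, map_smul, hx a b h] }
  have hL : ∀ x : ∀ a, M a, x ∈ L ↔ ∀ (a b : ℕ) (h : b ≤ a), red a b h (x a) = x b :=
    fun x => Iff.rfl
  -- stabilisation and the stable image
  obtain ⟨n₀, hn₀⟩ := exists_range_d_eq tup δ hd_tup
  let D : Submodule S (M 1) := LinearMap.range (red (n₀ + 1) 1 (Nat.le_add_left 1 n₀))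
  have hLD : ∀ x ∈ L, x 1 ∈ D := fun x hx => ⟨x (n₀ + 1), hx _ _ _⟩
  have hDL : ∀ d ∈ D, ∃ x ∈ L, x 1 = d := fun d hd => by
    obtain ⟨z, hz, hz1⟩ :=
      exists_compatible_of_mem_range red tup δ hrid hrr hrt0 hd_ker hd_tup hn₀ hd
    exact ⟨z, hz, hz1⟩
  have hK : 𝔞 ^ (K₀ * n₀) • (⊤ : Submodule S (M 1)) ≤ D :=
    pow_smul_top_le_range_red red δ hrid hrr hd_ker 𝔞 hH n₀
  -- torsion
  have htf : ∀ x ∈ L, t • x = 0 → x = 0 := fun x hx htx =>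
    eq_zero_of_smul_eq_zero_of_compatible red tup htinj htr x hx fun a => by
      have := congrFun htx a
      simpa using this
  -- the projection `L → D` and its kernel
  let proj : L →ₗ[S] D :=
    { toFun := fun x => ⟨x.1 1, hLD x.1 x.2⟩
      map_add' := fun x x' => rfl
      map_smul' := fun c x => rfl }
  have hproj_surj : Function.Surjective proj := fun d => by
    obtain ⟨x, hx, hx1⟩ := hDL d.1 d.2
    exact ⟨⟨x, hx⟩, Subtype.ext hx1⟩
  have hker_eq : LinearMap.ker proj = (t • ⊤ : Submodule S L) := by
    apply le_antisymm
    · intro x hx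
      have hx1 : x.1 1 = 0 := congrArg Subtype.val (LinearMap.mem_ker.mp hx)
      obtain ⟨z, hz, hxz⟩ := exists_eq_smul_of_compatible_of_apply_one_eq_zero red tup hM0 hrid
        hrr htinj hrt htr hker x.1 x.2 hx1
      refine (Submodule.mem_smul_pointwise_iff_exists _ _ _).mpr ⟨⟨z, hz⟩, Submodule.mem_top, ?_⟩
      exact Subtype.ext hxz.symm
    · intro x hx
      obtain ⟨z, -, rfl⟩ := (Submodule.mem_smul_pointwise_iff_exists _ _ _).mp hx
      rw [LinearMap.mem_ker]
      apply Subtype.ext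
      change t • z.1 1 = 0
      have := pow_smul_eq_zero_of_tower red tup hM0 htr 1 (z.1 1)
      rwa [pow_one] at this
  let e : (L ⧸ (t • ⊤ : Submodule S L)) ≃ₗ[S] D :=
    (Submodule.quotEquivOfEq _ _ hker_eq.symm).trans
      (LinearMap.quotKerEquivOfSurjective proj hproj_surj)
  -- finiteness: `L = Σ S mᵢ + t L` for lifts `mᵢ` of generators of `D`
  haveI : IsNoetherian S (M 1) := isNoetherian_of_isNoetherianRing_of_finite S (M 1)
  obtain ⟨G, hG⟩ := (IsNoetherian.noetherian D : D.FG)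
  let g : Fin G.card → M 1 := fun i => (G.equivFin.symm i : M 1)
  have hgD : ∀ i, g i ∈ D := fun i => hG ▸ Submodule.subset_span (G.equivFin.symm i).2
  have hspan : ∀ d ∈ D, ∃ c : Fin G.card → S, ∑ i, c i • g i = d := by
    intro d hd
    rw [← hG] at hd
    have hrange : Set.range g = (G : Set (M 1)) := by
      ext m
      constructor
      · rintro ⟨i, rfl⟩; exact (G.equivFin.symm i).2
      · intro hm; exact ⟨G.equivFin ⟨m, hm⟩, by simp [g]⟩
    rw [← hrange] at hd
    exact (Submodule.mem_span_range_iff_exists_fun S).mp hd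
  choose m hmL hm1 using fun i => hDL (g i) (hgD i)
  have hgen : ∀ x : L, ∃ (c : Fin G.card → S) (x' : L),
      x = ∑ i, c i • ⟨m i, hmL i⟩ + t • x' := by
    intro x
    obtain ⟨c, hc⟩ := hspan (x.1 1) (hLD x.1 x.2)
    have hw : x - ∑ i, c i • (⟨m i, hmL i⟩ : L) ∈ LinearMap.ker proj := by
      rw [LinearMap.mem_ker]
      apply Subtype.ext
      change (x - ∑ i, c i • (⟨m i, hmL i⟩ : L)).1 1 = 0
      simp only [AddSubgroupClass.coe_sub, Submodule.coe_sum, Submodule.coe_smul, Pi.sub_apply,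
        Finset.sum_apply, Pi.smul_apply, hm1, hc, sub_self]
    rw [hker_eq] at hw
    obtain ⟨x', -, hx'⟩ := (Submodule.mem_smul_pointwise_iff_exists _ _ _).mp hw
    exact ⟨c, x', by rw [hx']; abel⟩
  have hsep : ∀ x : L, (∀ N : ℕ, ∃ y : L, x = t ^ N • y) → x = 0 := by
    intro x hx
    apply Subtype.ext
    funext a
    obtain ⟨y, hy⟩ := hx a
    rw [hy]
    change (t ^ a • y.1) a = 0
    rw [Pi.smul_apply]
    exact pow_smul_eq_zero_of_tower red tup hM0 htr a (y.1 a)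
  have hfin : Module.Finite S L := by
    refine Module.Finite.of_surjective (Fintype.linearCombination S fun i => (⟨m i, hmL i⟩ : L))
      fun x => ?_
    obtain ⟨a, ha⟩ := exists_eq_sum_smul_of_forall_add_smul 𝔞 h𝔞 ht𝔞 hsep _ hgen x
    exact ⟨a, by rw [Fintype.linearCombination_apply, ha]⟩
  exact ⟨L, D, K₀ * n₀, hL, hK, hLD, hDL, htf, hfin, ⟨e⟩⟩

end Tower

end Literature.RingTheory.RegularLocalRing

end
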